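import Literature.Order.WellQuasiOrder.AntitoneSequences
import Mathlib.Order.UpperLower.CompleteLattice
import Mathlib.Order.Fin.Tuple
import Mathlib.Order.Antichain
import Mathlib.Data.Fintype.Powerset
import HarnessLib

/-!
# Maclagan's theorem: the upper sets of `ℕⁿ` are well-quasi-ordered by reverse inclusion;
# antichains of monomial ideals are finite (Maclagan 2001, Thm. 1.2)

Topic: `Literature/Order/WellQuasiOrder`. D. Maclagan, *Antichains of monomial ideals are
finite*, Proc. AMS 129 (2001): **Theorem 1.2.** "Let `L` be the poset of dual order ideals of
the poset `ℕⁿ`, ordered by containment. Then `L` contains no infinite antichains." (Thm. 1.1 is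
the same statement for monomial ideals of `k[x_1, …, x_n]`, which correspond to dual order
ideals = upper sets of exponent vectors.) This is the combinatorial input of
Cossart–Jannsen–Saito, LNM 2270, Thm. 2.15 (the set `HF_n` of Hilbert functions is a Noetherian
ordered set), there quoted as "the main theorem in [MacI] (Theorem 1.1)"; Aschenbrenner–Pong
(Cor. 1.8) phrase it as: the monomial ideals under REVERSE inclusion form a Noetherian
(= well-quasi-) ordered set — which is the (slightly stronger) form PROVED here, for Mathlib's
`UpperSet (Fin n → ℕ)`, whose order IS reverse inclusion:

* `wellQuasiOrderedLE_upperSet_natProd` — if the upper sets of a preorder `α` are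
  well-quasi-ordered then so are the upper sets of `ℕ × α`: an upper set `A ⊆ ℕ × α` is the same
  as the antitone sequence of its slices `c ↦ {a | (c, a) ∈ A}` (`sliceOrderIso`), and antitone
  sequences in a well-quasi-ordered partial order are well-quasi-ordered
  (`wellQuasiOrderedLE_antitone`, `AntitoneSequences.lean`, via Higman's lemma).
* `wellQuasiOrderedLE_upperSet_finNat` — **`WellQuasiOrderedLE (UpperSet (Fin n → ℕ))`**, by
  induction on `n` (`Fin.consOrderIso`, `UpperSet.map`).
* Maclagan's statements: `Maclagan.exists_lt_coe_subset` (every sequence `A₀, A₁, …` of upper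
  sets of `ℕⁿ` has `i < j` with `A_j ⊆ A_i`), `Maclagan.finite_of_isAntichain` (**Thm. 1.2**:
  antichains are finite), `Maclagan.exists_ssubset_of_infinite` (an infinite family contains
  `A ⊊ B`), `Maclagan.wellFoundedGT_upperSet` (no infinite strictly ⊆-decreasing… i.e. every
  strictly increasing-by-inclusion chain is finite: the Noetherian property).

The monomial-ideal dictionary (Thm. 1.1 verbatim) is in `MonomialIdeals.lean`.

## Sources

* D. Maclagan, Proc. Amer. Math. Soc. 129 (2001) 1609–1615 = arXiv:math/9909168, Thm. 1.1,
  Thm. 1.2. [Maclagan2001]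
* M. Aschenbrenner, W. Y. Pong, *Orderings of monomial ideals*, Fund. Math. 181 (2004), Cor. 1.8
  (as cited by CJS, Rem. 2.16 (b)). [folklore]
* V. Cossart, U. Jannsen, S. Saito, LNM 2270 (2020), Thm. 2.15 and Rem. 2.16 (the use).
  [CossartJannsenSaito2020]
-/

namespace Literature.Order.WellQuasiOrder

/-! ## Upper sets of `ℕ × α` as antitone sequences of upper sets of `α` -/

section Slices

variable {α : Type*} [Preorder α]

/-- The slice `A_c = {a | (c, a) ∈ A}` of an upper set of `ℕ × α`; an upper set of `α`. [folklore] -/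
def natSlice (A : UpperSet (ℕ × α)) (c : ℕ) : UpperSet α :=
  ⟨{a | (c, a) ∈ A}, fun _ _ hab ha => A.upper (Prod.mk_le_mk.mpr ⟨le_rfl, hab⟩) ha⟩

/-- Membership in a slice. [folklore] -/
@[simp] theorem mem_natSlice {A : UpperSet (ℕ × α)} {c : ℕ} {a : α} :
    a ∈ natSlice A c ↔ (c, a) ∈ A := Iff.rfl

/-- The slices increase with `c` as sets, i.e. DEcrease in `UpperSet α` (reverse inclusion):
`c ↦ A_c` is antitone. [folklore] -/
theorem antitone_natSlice (A : UpperSet (ℕ × α)) : Antitone (natSlice A) := by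
  intro c c' hcc' a ha
  -- `ha : a ∈ natSlice A c` (goal: `a ∈ natSlice A c'`… in `UpperSet`, `s ≤ t ↔ t ⊆ s`)
  exact A.upper (Prod.mk_le_mk.mpr ⟨hcc', le_rfl⟩) ha

/-- Reassembling an upper set of `ℕ × α` from an antitone sequence of upper sets of `α`.
[folklore] -/
def ofNatSlices (s : {s : ℕ → UpperSet α // Antitone s}) : UpperSet (ℕ × α) :=
  ⟨{p | p.2 ∈ s.1 p.1}, fun p q hpq hp => by
    have h1 : p.2 ∈ s.1 q.1 := s.2 (Prod.le_def.mp hpq).1 hp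
    exact (s.1 q.1).upper (Prod.le_def.mp hpq).2 h1⟩

/-- Membership in the reassembled upper set. [folklore] -/
@[simp] theorem mem_ofNatSlices {s : {s : ℕ → UpperSet α // Antitone s}} {p : ℕ × α} :
    p ∈ ofNatSlices s ↔ p.2 ∈ s.1 p.1 := Iff.rfl

/-- **Upper sets of `ℕ × α` ≃ antitone sequences of upper sets of `α`**, as ordered sets
(reverse inclusion on both sides, pointwise on sequences). [folklore] -/
def sliceOrderIso : UpperSet (ℕ × α) ≃o {s : ℕ → UpperSet α // Antitone s} where
  toFun A := ⟨natSlice A, antitone_natSlice A⟩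
  invFun := ofNatSlices
  left_inv A := by ext ⟨c, a⟩; rfl
  right_inv s := by
    apply Subtype.ext
    funext c
    ext a
    rfl
  map_rel_iff' := by
    intro A B
    constructor
    · intro h ⟨c, a⟩ hp
      exact (h c : natSlice A c ≤ natSlice B c) hp
    · intro h c a ha
      exact h ha

/-- **If the upper sets of `α` are well-quasi-ordered (by reverse inclusion), so are the upper
sets of `ℕ × α`.** [cite: Maclagan2001, Thm. 1.2 (proof)] -/
theorem wellQuasiOrderedLE_upperSet_natProd [WellQuasiOrderedLE (UpperSet α)] :
    WellQuasiOrderedLE (UpperSet (ℕ × α)) :=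
  (sliceOrderIso (α := α)).wellQuasiOrderedLE_iff.mpr wellQuasiOrderedLE_antitone

end Slices

/-! ## Upper sets of `ℕⁿ` -/

/-- Upper sets of a finite preorder form a finite type. [folklore] -/
instance {α : Type*} [Preorder α] [Finite α] : Finite (UpperSet α) :=
  Finite.of_injective (fun s : UpperSet α => (s : Set α)) fun _ _ h => UpperSet.ext h

/-- **Maclagan's theorem, well-quasi-order form: the upper sets (dual order ideals) of `ℕⁿ`,
ordered by reverse inclusion, are well-quasi-ordered.** Induction on `n`:
`ℕⁿ⁺¹ ≅ ℕ × ℕⁿ` (`Fin.consOrderIso`) and `wellQuasiOrderedLE_upperSet_natProd`.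
[cite: Maclagan2001, Thm. 1.2] -/
theorem wellQuasiOrderedLE_upperSet_finNat : ∀ n : ℕ, WellQuasiOrderedLE (UpperSet (Fin n → ℕ))
  | 0 => Finite.to_wellQuasiOrderedLE
  | n + 1 => by
    haveI := wellQuasiOrderedLE_upperSet_finNat n
    haveI : WellQuasiOrderedLE (UpperSet (ℕ × (Fin n → ℕ))) := wellQuasiOrderedLE_upperSet_natProd
    exact (UpperSet.map (Fin.consOrderIso fun _ : Fin (n + 1) => ℕ)).wellQuasiOrderedLE_iff.mp
      inferInstance

namespace Maclagan

variable {n : ℕ}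

/-- **Maclagan, sequence form**: in any sequence `A₀, A₁, …` of upper sets of `ℕⁿ` there are
`i < j` with `A_j ⊆ A_i`. [cite: Maclagan2001, Thm. 1.2] -/
theorem exists_lt_coe_subset (A : ℕ → UpperSet (Fin n → ℕ)) :
    ∃ i j, i < j ∧ (A j : Set (Fin n → ℕ)) ⊆ A i := by
  obtain ⟨i, j, hij, hle⟩ := (wellQuasiOrderedLE_upperSet_finNat n).wqo A
  exact ⟨i, j, hij, UpperSet.coe_subset_coe.mpr hle⟩

/-- **Maclagan 2001, Thm. 1.2: antichains of upper sets (dual order ideals) of `ℕⁿ` are finite.**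
[cite: Maclagan2001, Thm. 1.2] -/
theorem finite_of_isAntichain {S : Set (UpperSet (Fin n → ℕ))} (hS : IsAntichain (· ≤ ·) S) :
    S.Finite :=
  haveI := wellQuasiOrderedLE_upperSet_finNat n
  WellQuasiOrderedLE.finite_of_isAntichain hS

/-- Antichains for inclusion are the same as antichains for reverse inclusion. [folklore] -/
theorem isAntichain_subset_iff {S : Set (UpperSet (Fin n → ℕ))} :
    IsAntichain (fun A B : UpperSet (Fin n → ℕ) => (A : Set (Fin n → ℕ)) ⊆ B) S ↔
      IsAntichain (· ≤ ·) S := by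
  constructor
  · intro h A hA B hB hne hle
    exact h hB hA hne.symm (UpperSet.coe_subset_coe.mpr hle)
  · intro h A hA B hB hne hsub
    exact h hB hA hne.symm (UpperSet.coe_subset_coe.mp hsub)

/-- **Maclagan 2001, Thm. 1.2, as printed for containment**: an infinite family of upper sets of
`ℕⁿ` contains two members `A ≠ B` with `A ⊆ B`. [cite: Maclagan2001, Thm. 1.2] -/
theorem exists_ne_coe_subset_of_infinite {S : Set (UpperSet (Fin n → ℕ))} (hS : S.Infinite) :
    ∃ A ∈ S, ∃ B ∈ S, A ≠ B ∧ (A : Set (Fin n → ℕ)) ⊆ B := by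
  by_contra h
  push Not at h
  apply hS
  refine finite_of_isAntichain fun A hA B hB hne hle => ?_
  exact h B hB A hA hne.symm (UpperSet.coe_subset_coe.mpr hle) -- `B ≤? ` : `hle : A ≤ B ↔ B ⊆ A`

/-- The Noetherian half: there is no infinite strictly increasing (for inclusion) sequence of
upper sets of `ℕⁿ` — `UpperSet (Fin n → ℕ)` (reverse inclusion) is well-founded.
[cite: Maclagan2001, Thm. 1.2] -/
theorem wellFoundedLT_upperSet : WellFoundedLT (UpperSet (Fin n → ℕ)) :=
  haveI := wellQuasiOrderedLE_upperSet_finNat n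
  inferInstance

end Maclagan

end Literature.Order.WellQuasiOrder
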